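import Mathlib
import Summits.Ventures.LatticeQCDFlow.TrivializingMaps.TruncatedFlowLightCone
import HarnessLib

/-!
HONEST FRAMING: exact (Metropolis-corrected) sampling algorithms for lattice gauge theory; figures
of merit are autocorrelation/cost numbers at stated couplings and volumes; no continuum-physics
claim.

# TruncatedFlowReceptiveField — the order-`N` Wilson-flow map is a STRICTLY LOCAL map up to
# `2n e^{ct}(ct)^m/m!`, with a receptive radius independent of the volume (THEORY-1.md §26.3 (a) made a
# theorem; cell pub-lqcd, lean-2 GEN-5)

THEORY-1 §26.3 (a) reads THEOREM L as a statement about NETWORK SIZE: "a network emulating `Φ_t` to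
accuracy `ε` per link needs a receptive radius `r(ε)` INDEPENDENT OF `L`".  This file turns the reading
into a theorem about maps.  For a field map `F : SU(n)^E → SU(n)^E`, a radius `R·m` and a reference field
`V₀`, the **localization** `localize R m V₀ F` evaluates `F` at link `e` on the input FROZEN TO `V₀`
OUTSIDE the plaquette ball `linkBall (R m) e` (§1); by construction its `e`-component depends only on the
links in that ball (`localize_dependsOn`) — it is a strictly local map of range `R·m` in the sense of
PROPOSITION R (`FiniteRangeDecorrelation`, `DependsOn`).  The light cone of `TruncatedFlowLightCone.lean`
then gives (§2):

* `truncatedFlow_receptiveField` — for `n ≠ 0`, `T ≥ 0`, every `L`, every smooth solution of Lüscher's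
  recursion for `β·S_W`, every flow map `Φ` of `-∂S̃^{[N]}_t`, every reference field `V₀`, every `m`,
  every input `V`, every link `e` and all `t ∈ [0, T]`:
  `‖Φ_t(V)_e - (localize (2(N+1)) m V₀ (Φ t)) (V)_e‖_F ≤ 2n · e^{ct}(ct)^m/m!`, `c = coneRate d n B β T N`;
* `truncatedFlow_exists_strictlyLocal_approx` — hence for each `t ∈ [0, T]` and `m` there IS a strictly
  local map `Ψ` of range `2(N+1)·m` with `‖Φ_t(V)_e - Ψ(V)_e‖_F ≤ 2n · e^{ct}(ct)^m/m!` for all `V, e`;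
* `truncatedFlow_observable_lightCone` — the observable (`ℓ¹`) form, R-T1-82: a sup-Lipschitz
  observable of the links of `S` moves by `≤ ℓ_A·2n e^{ct}(ct)^m/m!` under input modifications outside
  the balls `linkBall (2(N+1)m) e`, `e ∈ S`;
* `truncatedFlow_receptiveField_uniform` — the same with the quantifier order `∃ c ≥ 0, ∀ L, …`: ONE
  rate for ALL volumes, i.e. the receptive radius needed for per-link accuracy `ε` is
  `2(N+1)·m(ε)` links with `m(ε)` determined by `2n e^{ct}(ct)^m/m! ≤ ε` — a function of
  `d, n, B, β, T, N, ε` and NOT of `L` (the explicit depth `m(ε,t) = ⌈max(e²ct, ct + log(2n/ε))⌉₊`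
  via theory-1's `LightConeProfileDecay` is recorded in `TruncatedFlowDecorrelation.lean`).

NOT claimed: that the local rule is the same at every link (translation covariance of the flow map is a
separate statement, cf. `LinkSymmetry`), any parameter count of an actual network, any cost or acceptance
statement.

References: M. Lüscher, Commun. Math. Phys. 293 (2010) 899 [Luscher2010Trivializing], §3.2, §4.5(b);
THEORY-1.md §26.3; theory-2 `Scaling/LocalFlows`, `Scaling/ReceptiveField` (the discrete-layer
counterparts).
-/

noncomputable section

namespace Summit.Ventures.LatticeQCDFlow.TrivializingMaps

open Literature.MathematicalPhysics.QuantumFieldTheory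
open Literature.MathematicalPhysics.QuantumFieldTheory.Luscher2010
open Literature.MathematicalPhysics.QuantumFieldTheory.WilsonFlow (coeConfig)
open scoped Matrix Matrix.Norms.Frobenius Nat ContDiff

variable {d L n : ℕ}

/-! ## §1. Freezing a field outside a set of links; localization of a field map -/

section Localize

variable {G : Type*}

open scoped Classical in
/-- The field `V` FROZEN TO `V₀` OUTSIDE `S`: equal to `V` on `S` and to the reference field `V₀`
elsewhere. [ours] -/
def freezeOutside (S : Set (Edge d L)) (V₀ V : GaugeConfig d L G) : GaugeConfig d L G :=
  fun e => if e ∈ S then V e else V₀ e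

/-- On `S` the frozen field is the field. [ours] -/
theorem freezeOutside_of_mem {S : Set (Edge d L)} (V₀ V : GaugeConfig d L G) {e : Edge d L}
    (he : e ∈ S) : freezeOutside S V₀ V e = V e := by
  classical
  simp [freezeOutside, he]

/-- Off `S` the frozen field is the reference field. [ours] -/
theorem freezeOutside_of_not_mem {S : Set (Edge d L)} (V₀ V : GaugeConfig d L G) {e : Edge d L}
    (he : e ∉ S) : freezeOutside S V₀ V e = V₀ e := by
  classical
  simp [freezeOutside, he]

/-- Freezing depends only on the links in `S`. [ours] -/
theorem freezeOutside_dependsOn (S : Set (Edge d L)) (V₀ : GaugeConfig d L G) :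
    DependsOn (freezeOutside S V₀) S := by
  intro V V' h
  funext e
  classical
  by_cases he : e ∈ S
  · rw [freezeOutside_of_mem V₀ V he, freezeOutside_of_mem V₀ V' he, h e he]
  · rw [freezeOutside_of_not_mem V₀ V he, freezeOutside_of_not_mem V₀ V' he]

/-- **Localization of a field map to range `R·m`**: the `e`-component of `localize R m V₀ F` is the
`e`-component of `F` evaluated on the input frozen to `V₀` outside the plaquette ball `linkBall (R m) e`.
[ours] -/
def localize (R m : ℕ) (V₀ : GaugeConfig d L G) (F : GaugeConfig d L G → GaugeConfig d L G) :
    GaugeConfig d L G → GaugeConfig d L G :=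
  fun V e => F (freezeOutside (linkBall (R * m) e) V₀ V) e

/-- Unfolding lemma. [ours] -/
theorem localize_apply (R m : ℕ) (V₀ : GaugeConfig d L G) (F : GaugeConfig d L G → GaugeConfig d L G)
    (V : GaugeConfig d L G) (e : Edge d L) :
    localize R m V₀ F V e = F (freezeOutside (linkBall (R * m) e) V₀ V) e := rfl

/-- **The localization is a strictly local map of range `R·m`**: its `e`-component depends only on the
input links in `linkBall (R m) e` (the `DependsOn` form used by PROPOSITION R,
`FiniteRangeDecorrelation`). [ours] -/
theorem localize_dependsOn (R m : ℕ) (V₀ : GaugeConfig d L G)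
    (F : GaugeConfig d L G → GaugeConfig d L G) (e : Edge d L) :
    DependsOn (fun V => localize R m V₀ F V e) (linkBall (R * m) e) := by
  intro V V' h
  simp only [localize_apply]
  rw [freezeOutside_dependsOn (linkBall (R * m) e) V₀ h]

end Localize

/-! ## §2. The receptive field of the order-`N` truncated Wilson-flow map -/

section ReceptiveField

variable [NeZero L]

/-- **RECEPTIVE-FIELD THEOREM.**  For `n ≠ 0`, `T ≥ 0`, every smooth solution `S̃^{(k)}` of Lüscher's
recursion for `β·S_W`, every flow map `Φ` of `-∂S̃^{[N]}_t`, every reference field `V₀` and every `m`: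
the time-`t` map differs from its range-`2(N+1)·m` localization by at most `2n · e^{ct}(ct)^m/m!` at
every link, every input and every `t ∈ [0, T]`, `c = coneRate d n B β T N` (volume-free).
[ours; cf. Luscher2010Trivializing §3.2, §4.5(b)] -/
theorem truncatedFlow_receptiveField (hn : n ≠ 0) (B : SuBasis n) (β : ℝ) (N : ℕ) {T : ℝ} (hT : 0 ≤ T)
    {Sk : ℕ → AmbConfig d L n → ℝ} {c : ℕ → ℝ} (hsm : ∀ k, ContDiff ℝ ∞ (Sk k))
    (hser : IsLuscherSeries B (fun W => β * ambWilsonAction W) Sk c)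
    {Φ : ℝ → GaugeConfig d L (Matrix.specialUnitaryGroup (Fin n) ℂ) →
      GaugeConfig d L (Matrix.specialUnitaryGroup (Fin n) ℂ)}
    (hΦ : IsFlowMap (fun t W => -linkGrad B (truncFlowAction Sk t N) W) Φ)
    (V₀ : GaugeConfig d L (Matrix.specialUnitaryGroup (Fin n) ℂ)) (m : ℕ)
    (V : GaugeConfig d L (Matrix.specialUnitaryGroup (Fin n) ℂ)) (e : Edge d L) :
    ∀ t ∈ Set.Icc 0 T,
      ‖coeConfig (Φ t V) e - coeConfig (localize (2 * (N + 1)) m V₀ (Φ t) V) e‖ ≤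
        2 * n * Real.exp (coneRate d n B β T N * t) * (coneRate d n B β T N * t) ^ m / (m ! : ℝ) := by
  intro t ht
  have h := truncatedFlow_lightCone_ball hn B β N hT hsm hser hΦ e m V
    (freezeOutside (linkBall (2 * (N + 1) * m) e) V₀ V)
    (fun e' he' => (freezeOutside_of_mem V₀ V he').symm) t ht
  simpa only [WilsonFlow.coeConfig_apply, localize_apply] using h

/-- **A strictly local approximant exists at every range**, every volume: for each `t ∈ [0, T]` and `m`
there is a map `Ψ` whose `e`-component depends only on `linkBall (2(N+1)·m) e` and which is within
`2n · e^{ct}(ct)^m/m!` of `Φ_t` at every link and every input. [ours] -/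
theorem truncatedFlow_exists_strictlyLocal_approx (hn : n ≠ 0) (B : SuBasis n) (β : ℝ) (N : ℕ)
    {T : ℝ} (hT : 0 ≤ T) {Sk : ℕ → AmbConfig d L n → ℝ} {c : ℕ → ℝ} (hsm : ∀ k, ContDiff ℝ ∞ (Sk k))
    (hser : IsLuscherSeries B (fun W => β * ambWilsonAction W) Sk c)
    {Φ : ℝ → GaugeConfig d L (Matrix.specialUnitaryGroup (Fin n) ℂ) →
      GaugeConfig d L (Matrix.specialUnitaryGroup (Fin n) ℂ)}
    (hΦ : IsFlowMap (fun t W => -linkGrad B (truncFlowAction Sk t N) W) Φ)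
    {t : ℝ} (ht : t ∈ Set.Icc 0 T) (m : ℕ) :
    ∃ Ψ : GaugeConfig d L (Matrix.specialUnitaryGroup (Fin n) ℂ) →
        GaugeConfig d L (Matrix.specialUnitaryGroup (Fin n) ℂ),
      (∀ e, DependsOn (fun V => Ψ V e) (linkBall (2 * (N + 1) * m) e)) ∧
      ∀ V e, ‖coeConfig (Φ t V) e - coeConfig (Ψ V) e‖ ≤
        2 * n * Real.exp (coneRate d n B β T N * t) * (coneRate d n B β T N * t) ^ m / (m ! : ℝ) :=
  ⟨localize (2 * (N + 1)) m (fun _ => 1) (Φ t), localize_dependsOn _ m _ _,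
    fun V e => truncatedFlow_receptiveField hn B β N hT hsm hser hΦ (fun _ => 1) m V e t ht⟩

/-- **OBSERVABLE FORM (the `ℓ¹` corollary R-T1-82 of THEORY-1 §26.6).**  An observable `A` of the
output field that reads only the links of `S` and is sup-Lipschitz there with constant `ℓ_A`
(`|A(U) - A(U')| ≤ ℓ_A·η` whenever the links of `S` are `η`-close) changes by at most
`ℓ_A · 2n e^{ct}(ct)^m/m!` when the INPUT is modified outside the plaquette balls
`linkBall (2(N+1)·m) e`, `e ∈ S` — every volume. [ours] -/
theorem truncatedFlow_observable_lightCone (hn : n ≠ 0) (B : SuBasis n) (β : ℝ) (N : ℕ) {T : ℝ}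
    (hT : 0 ≤ T) {Sk : ℕ → AmbConfig d L n → ℝ} {c : ℕ → ℝ} (hsm : ∀ k, ContDiff ℝ ∞ (Sk k))
    (hser : IsLuscherSeries B (fun W => β * ambWilsonAction W) Sk c)
    {Φ : ℝ → GaugeConfig d L (Matrix.specialUnitaryGroup (Fin n) ℂ) →
      GaugeConfig d L (Matrix.specialUnitaryGroup (Fin n) ℂ)}
    (hΦ : IsFlowMap (fun t W => -linkGrad B (truncFlowAction Sk t N) W) Φ) (m : ℕ)
    {A : GaugeConfig d L (Matrix.specialUnitaryGroup (Fin n) ℂ) → ℝ} {S : Set (Edge d L)} {ℓA : ℝ}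
    (hAlip : ∀ (U U' : GaugeConfig d L (Matrix.specialUnitaryGroup (Fin n) ℂ)) (η : ℝ),
      (∀ e ∈ S, ‖coeConfig U e - coeConfig U' e‖ ≤ η) → |A U - A U'| ≤ ℓA * η)
    (V V' : GaugeConfig d L (Matrix.specialUnitaryGroup (Fin n) ℂ))
    (hVV' : ∀ e ∈ S, ∀ e' ∈ linkBall (2 * (N + 1) * m) e, V e' = V' e') :
    ∀ t ∈ Set.Icc 0 T, |A (Φ t V) - A (Φ t V')| ≤
      ℓA * (2 * n * Real.exp (coneRate d n B β T N * t) * (coneRate d n B β T N * t) ^ m / (m ! : ℝ)) :=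
  fun t ht => hAlip (Φ t V) (Φ t V') _ fun e he =>
    truncatedFlow_lightCone_ball hn B β N hT hsm hser hΦ e m V V' (hVV' e he) t ht

end ReceptiveField

/-- **RECEPTIVE RADIUS INDEPENDENT OF THE VOLUME (quantifier order).**  For `n ≠ 0`, `T ≥ 0` and fixed
`d, B, β, N` there is ONE rate `c ≥ 0` such that for EVERY `L`, every smooth solution for `β·S_W`, every
flow map `Φ` of `-∂S̃^{[N]}_t`, every `t ∈ [0, T]` and every `m` there is a strictly local map `Ψ` of range
`2(N+1)·m` with `‖Φ_t(V)_e - Ψ(V)_e‖_F ≤ 2n · e^{ct}(ct)^m/m!` for all `V, e`.  The receptive radius for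
per-link accuracy `ε` is therefore `2(N+1)·m(ε)` links with `m(ε)` the least `m` such that
`2n e^{cT}(cT)^m/m! ≤ ε` — a function of `d, n, B, β, T, N, ε`, not of `L`.
[ours; cf. Luscher2010Trivializing §3.2, §4.5(b); THEORY-1 §26.3 (a)] -/
theorem truncatedFlow_receptiveField_uniform (d : ℕ) {n : ℕ} (hn : n ≠ 0) (B : SuBasis n) (β : ℝ)
    (N : ℕ) {T : ℝ} (hT : 0 ≤ T) :
    ∃ c : ℝ, 0 ≤ c ∧ ∀ (L : ℕ) [NeZero L] (Sk : ℕ → AmbConfig d L n → ℝ) (cs : ℕ → ℝ),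
      (∀ k, ContDiff ℝ ∞ (Sk k)) → IsLuscherSeries B (fun W => β * ambWilsonAction W) Sk cs →
      ∀ (Φ : ℝ → GaugeConfig d L (Matrix.specialUnitaryGroup (Fin n) ℂ) →
          GaugeConfig d L (Matrix.specialUnitaryGroup (Fin n) ℂ)),
        IsFlowMap (fun t W => -linkGrad B (truncFlowAction Sk t N) W) Φ →
      ∀ t ∈ Set.Icc 0 T, ∀ m : ℕ,
        ∃ Ψ : GaugeConfig d L (Matrix.specialUnitaryGroup (Fin n) ℂ) →
            GaugeConfig d L (Matrix.specialUnitaryGroup (Fin n) ℂ),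
          (∀ e, DependsOn (fun V => Ψ V e) (linkBall (2 * (N + 1) * m) e)) ∧
          ∀ V e, ‖coeConfig (Φ t V) e - coeConfig (Ψ V) e‖ ≤
            2 * n * Real.exp (c * t) * (c * t) ^ m / (m ! : ℝ) :=
  ⟨coneRate d n B β T N, coneRate_nonneg d n B β hT N,
    fun _L _ _Sk _cs hsm hser _Φ hΦ _t ht m =>
      truncatedFlow_exists_strictlyLocal_approx hn B β N hT hsm hser hΦ ht m⟩

end Summit.Ventures.LatticeQCDFlow.TrivializingMaps

end
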